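import Summits.QuantumFields.YangMills.Theorems.LuscherReductionTwistedTraceScalingBOStiffNearSchedule
import Summits.QuantumFields.YangMills.Theorems.LuscherReductionTwistedTraceScalingBOStiffSlowAssembly
import Summits.QuantumFields.YangMills.Theorems.LuscherReductionTwistedTraceScalingBOStiffBasedForm
import Summits.QuantumFields.YangMills.Theorems.LuscherReductionTwistedTraceScalingBOStiffTubeForm
import Summits.QuantumFields.YangMills.Theorems.LuscherReductionTwistedTraceScalingBOStiffCentralData
import HarnessLib

/-!
# (B-ST) (W1-7a) `…BOStiffCoreForm`: the core piece's transfer form IS the slow ⊗ fibre pair form of `form_le_of_product_near`, β-pointwise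
# (lane A of S-BASE, crux `TwistedTraceScaling` stmt-QuantumFields-20203, C4-CORE, the (B-ST) pen; HANDOFF-g21 UPDATE 20:39Z (W1-7))

For a bounded measurable `v` on configurations whose support lies in the record windows (`v U ≠ 0 ⇒ U ∈ orthoTubeSet`, slow mean in the window `‖q(ū_k) − 1‖ ≤ δ`,
`‖relLinkVec U‖ ≤ r` with `r < r_f`), put `V (u,x) := 𝟙[x ∈ Bal_cap]·v(orthoTube u x)` on `U × X = GaugeConfig 3 1 SU2 × fibre`.  Then
★★★ `qform_basedAvg_eq_pairForm` — `⟨P₀v, K_β P₀v⟩ = ∫_p∫_q V p · G_β p q · V q d(σ³⊗π)²` with `G_β` THE WINDOWED BASED TUBE KERNEL of ✓`…BOStiffNearSchedule.hnear_record`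
(based kernel on the windows, `k·cM` off them) — ✓`qform_basedAvg_eq_basedKernel_form` ∘ ✓`kernelForm_eq_tube_integral` ∘ (the windows carry `V`); and `V` is measurable, bounded and
supported in `U × cS β` (`cS` = support of the central profile `cΘ`, ✓`…BOStiffDefs`), `G_β` is jointly measurable and bounded (§1) — i.e. EVERY structural hypothesis of
✓`…BOStiffSlowAssembly.form_le_of_product_near` about `v`, `G` holds for the record core piece; ★★★ `core_pairForm_le` then applies it (hnear/hfib/hkop as literal hypotheses).
HONEST FRAMING: bookkeeping for a stub of a child of the CONDITIONAL route R2b1; (B-ST) OPEN; C4-CORE OPEN; not infinite volume, not a gap, not Clay.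
-/

set_option autoImplicit false

noncomputable section

open MeasureTheory Filter Topology Real
open scoped BigOperators
open Literature.MathematicalPhysics.QuantumFieldTheory
open Literature.MathematicalPhysics.QuantumLattice

namespace Summit.QuantumFields.YangMills.Theorems.FemtoTransferGap.TwoLattice.ConstTube

open Summit.QuantumFields.YangMills.Theorems.FemtoTransferGap
open Summit.QuantumFields.YangMills.Theorems.FemtoTransferGap.TwoLattice
open Summit.QuantumFields.YangMills.Theorems.FemtoTransferGap.TwoLattice.Avg
open Summit.QuantumFields.YangMills.Theorems.FemtoTransferGap.TwoLattice.Stiff (LinkSpace)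
open Summit.QuantumFields.YangMills.Theorems.FemtoTransferGap.TwoLattice.GnChart
open Summit.QuantumFields.YangMills.Theorems.TwistedTraceScaling.Negative

variable {L : ℕ} [NeZero L]

/-! ## §1 The based kernel on configuration pairs and the windowed tube kernel `G_β` -/

/-- `(U,V) ↦ ∫ K_β(U, V^{bE h}) dh` is jointly measurable. [folklore] -/
theorem measurable_basedKernel_uncurry (β : ℝ) :
    Measurable fun p : GaugeConfig 3 L SU2 × GaugeConfig 3 L SU2 => ∫ h, transferKernel su2Rep β p.1 (gaugeTransform (basedExt L h) p.2) ∂basedMeasure L := by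
  have hK : Measurable fun q : GaugeConfig 3 L SU2 × GaugeConfig 3 L SU2 => transferKernel su2Rep β q.1 q.2 :=
    (continuous_transferKernel su2Rep continuous_su2Rep β).measurable
  have h2a : Measurable fun p : (GaugeConfig 3 L SU2 × GaugeConfig 3 L SU2) × (NzSite L → SU2) => (p.1.2, basedExt L p.2) :=
    (measurable_snd.comp measurable_fst).prodMk ((measurable_basedExt L).comp measurable_snd)
  have h2 : Measurable fun p : (GaugeConfig 3 L SU2 × GaugeConfig 3 L SU2) × (NzSite L → SU2) => gaugeTransform (basedExt L p.2) p.1.2 := by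
    have h := (measurable_gaugeAction (L := L)).comp h2a; simpa only [Function.comp_def] using h
  have h3 : Measurable fun p : (GaugeConfig 3 L SU2 × GaugeConfig 3 L SU2) × (NzSite L → SU2) => transferKernel su2Rep β p.1.1 (gaugeTransform (basedExt L p.2) p.1.2) := by
    have h := hK.comp ((measurable_fst.comp measurable_fst).prodMk h2); simpa only [Function.comp_def] using h
  exact (h3.stronglyMeasurable.integral_prod_right' (ν := basedMeasure L)).measurable

/-- `|∫ K_β(U, V^{bE h}) dh| ≤ e^{2β|E|}` (`β ≥ 0`). [folklore] -/
theorem abs_basedKernel_le {β : ℝ} (hβ : 0 ≤ β) (U V : GaugeConfig 3 L SU2) :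
    |∫ h, transferKernel su2Rep β U (gaugeTransform (basedExt L h) V) ∂basedMeasure L| ≤ Real.exp (β * (2 * (Fintype.card (Edge 3 L) : ℝ))) := by
  rw [abs_of_nonneg (basedIntegral_nonneg β U V)]; exact basedIntegral_le_expCard hβ U V

omit [NeZero L] in
/-- The slow window `{u | ∀ k, ‖q(u_k) − 1‖ ≤ δ}` is measurable. [folklore] -/
theorem measurableSet_slowWindow' (δ : ℝ) : MeasurableSet {u : GaugeConfig 3 1 SU2 | ∀ k : Fin 3, ‖su2Quat (u (0, k)) - 1‖ ≤ δ} := by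
  haveI : SecondCountableTopology SU2 := secondCountableTopology_su2
  have hq := @Literature.MathematicalPhysics.QuantumFieldTheory.Balaban1983to89.T4HaarSU2Translate.continuous_su2Quat
  have e : {u : GaugeConfig 3 1 SU2 | ∀ k : Fin 3, ‖su2Quat (u (0, k)) - 1‖ ≤ δ} = ⋂ k : Fin 3, {u | ‖su2Quat (u (0, k)) - 1‖ ≤ δ} := by ext u; simp
  rw [e]
  refine MeasurableSet.iInter fun k => ?_
  have hc : Continuous fun u : GaugeConfig 3 1 SU2 => ‖su2Quat (u (0, k)) - 1‖ :=
    ((hq.comp (continuous_apply (((0 : Site 3 1), k) : Edge 3 1))).sub continuous_const).norm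
  exact measurableSet_le hc.measurable measurable_const

/-- The fibre window `{x ∈ Bal_cap | ‖x̂‖ ≤ R}` is measurable. [folklore] -/
theorem measurableSet_fibreWindow (R : ℝ) : MeasurableSet {x : Edge 3 L → Fin 3 → ℝ | x ∈ capBalancedSet L ∧ ‖linkEmbed L x‖ ≤ R} :=
  (measurableSet_capBalancedSet L).inter (measurableSet_le (measurable_linkEmbed (L := L)).norm measurable_const)

open Classical in
/-- ★ **The windowed based tube kernel `G_β` is jointly measurable.** [folklore] -/
theorem measurable_windowedKernel (β δ R : ℝ) :
    Measurable (Function.uncurry fun p q : GaugeConfig 3 1 SU2 × (Edge 3 L → Fin 3 → ℝ) =>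
      if (∀ k : Fin 3, ‖su2Quat (p.1 (0, k)) - 1‖ ≤ δ) ∧ (∀ k : Fin 3, ‖su2Quat (q.1 (0, k)) - 1‖ ≤ δ) ∧
          p.2 ∈ capBalancedSet L ∧ q.2 ∈ capBalancedSet L ∧ ‖linkEmbed L p.2‖ ≤ R ∧ ‖linkEmbed L q.2‖ ≤ R
        then ∫ h, transferKernel su2Rep β (orthoTube L p.1 p.2) (gaugeTransform (basedExt L h) (orthoTube L q.1 q.2)) ∂basedMeasure L
        else transferKernel su2Rep ((L : ℝ) ^ 3 * β) p.1 q.1 / transferKernel su2Rep ((L : ℝ) ^ 3 * β) (1 : GaugeConfig 3 1 SU2) 1 * cM L β p.2 q.2) := by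
  have hoT : Measurable fun p : GaugeConfig 3 1 SU2 × (Edge 3 L → Fin 3 → ℝ) => orthoTube L p.1 p.2 := measurable_orthoTube (L := L)
  have hthen : Measurable fun r : (GaugeConfig 3 1 SU2 × (Edge 3 L → Fin 3 → ℝ)) × (GaugeConfig 3 1 SU2 × (Edge 3 L → Fin 3 → ℝ)) =>
      ∫ h, transferKernel su2Rep β (orthoTube L r.1.1 r.1.2) (gaugeTransform (basedExt L h) (orthoTube L r.2.1 r.2.2)) ∂basedMeasure L := by
    have h := (measurable_basedKernel_uncurry (L := L) β).comp ((hoT.comp measurable_fst).prodMk (hoT.comp measurable_snd))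
    simpa only [Function.comp_def] using h
  have hK1 : Measurable fun q : GaugeConfig 3 1 SU2 × GaugeConfig 3 1 SU2 => transferKernel su2Rep ((L : ℝ) ^ 3 * β) q.1 q.2 :=
    (continuous_transferKernel su2Rep continuous_su2Rep _).measurable
  have helse : Measurable fun r : (GaugeConfig 3 1 SU2 × (Edge 3 L → Fin 3 → ℝ)) × (GaugeConfig 3 1 SU2 × (Edge 3 L → Fin 3 → ℝ)) =>
      transferKernel su2Rep ((L : ℝ) ^ 3 * β) r.1.1 r.2.1 / transferKernel su2Rep ((L : ℝ) ^ 3 * β) (1 : GaugeConfig 3 1 SU2) 1 * cM L β r.1.2 r.2.2 := by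
    have hg : Measurable fun r : (GaugeConfig 3 1 SU2 × (Edge 3 L → Fin 3 → ℝ)) × (GaugeConfig 3 1 SU2 × (Edge 3 L → Fin 3 → ℝ)) => (r.1.1, r.2.1) :=
      (measurable_fst.comp measurable_fst).prodMk (measurable_fst.comp measurable_snd)
    have h1 : Measurable fun r : (GaugeConfig 3 1 SU2 × (Edge 3 L → Fin 3 → ℝ)) × (GaugeConfig 3 1 SU2 × (Edge 3 L → Fin 3 → ℝ)) =>
        transferKernel su2Rep ((L : ℝ) ^ 3 * β) r.1.1 r.2.1 := by
      have h := hK1.comp hg; simpa only [Function.comp_def] using h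
    have hg2 : Measurable fun r : (GaugeConfig 3 1 SU2 × (Edge 3 L → Fin 3 → ℝ)) × (GaugeConfig 3 1 SU2 × (Edge 3 L → Fin 3 → ℝ)) => (r.1.2, r.2.2) :=
      (measurable_snd.comp measurable_fst).prodMk (measurable_snd.comp measurable_snd)
    have h2 : Measurable fun r : (GaugeConfig 3 1 SU2 × (Edge 3 L → Fin 3 → ℝ)) × (GaugeConfig 3 1 SU2 × (Edge 3 L → Fin 3 → ℝ)) => cM L β r.1.2 r.2.2 := by
      have h := (measurable_cM (L := L) β).comp hg2; simpa only [Function.comp_def, Function.uncurry] using h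
    exact (h1.div_const _).mul h2
  have hW := measurableSet_slowWindow' δ
  have hF := measurableSet_fibreWindow (L := L) R
  have hcond : MeasurableSet {r : (GaugeConfig 3 1 SU2 × (Edge 3 L → Fin 3 → ℝ)) × (GaugeConfig 3 1 SU2 × (Edge 3 L → Fin 3 → ℝ)) |
      (∀ k : Fin 3, ‖su2Quat (r.1.1 (0, k)) - 1‖ ≤ δ) ∧ (∀ k : Fin 3, ‖su2Quat (r.2.1 (0, k)) - 1‖ ≤ δ) ∧
        r.1.2 ∈ capBalancedSet L ∧ r.2.2 ∈ capBalancedSet L ∧ ‖linkEmbed L r.1.2‖ ≤ R ∧ ‖linkEmbed L r.2.2‖ ≤ R} := by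
    have e : {r : (GaugeConfig 3 1 SU2 × (Edge 3 L → Fin 3 → ℝ)) × (GaugeConfig 3 1 SU2 × (Edge 3 L → Fin 3 → ℝ)) |
        (∀ k : Fin 3, ‖su2Quat (r.1.1 (0, k)) - 1‖ ≤ δ) ∧ (∀ k : Fin 3, ‖su2Quat (r.2.1 (0, k)) - 1‖ ≤ δ) ∧
          r.1.2 ∈ capBalancedSet L ∧ r.2.2 ∈ capBalancedSet L ∧ ‖linkEmbed L r.1.2‖ ≤ R ∧ ‖linkEmbed L r.2.2‖ ≤ R} =
        ((fun r => r.1.1) ⁻¹' {u | ∀ k : Fin 3, ‖su2Quat (u (0, k)) - 1‖ ≤ δ}) ∩ ((fun r => r.2.1) ⁻¹' {u | ∀ k : Fin 3, ‖su2Quat (u (0, k)) - 1‖ ≤ δ}) ∩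
          ((fun r => r.1.2) ⁻¹' {x | x ∈ capBalancedSet L ∧ ‖linkEmbed L x‖ ≤ R}) ∩ ((fun r => r.2.2) ⁻¹' {x | x ∈ capBalancedSet L ∧ ‖linkEmbed L x‖ ≤ R}) := by
      ext r; simp only [Set.mem_setOf_eq, Set.mem_inter_iff, Set.mem_preimage]; tauto
    rw [e]
    exact (((measurable_fst.comp measurable_fst) hW).inter ((measurable_fst.comp measurable_snd) hW)).inter ((measurable_snd.comp measurable_fst) hF) |>.inter
      ((measurable_snd.comp measurable_snd) hF)
  exact Measurable.ite hcond hthen helse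

open Classical in
/-- ★ **`|G_β| ≤ e^{2β|E|}`** (`β ≥ 0`). [folklore] -/
theorem abs_windowedKernel_le {β : ℝ} (hβ : 0 ≤ β) (δ R : ℝ) (p q : GaugeConfig 3 1 SU2 × (Edge 3 L → Fin 3 → ℝ)) :
    |(if (∀ k : Fin 3, ‖su2Quat (p.1 (0, k)) - 1‖ ≤ δ) ∧ (∀ k : Fin 3, ‖su2Quat (q.1 (0, k)) - 1‖ ≤ δ) ∧
          p.2 ∈ capBalancedSet L ∧ q.2 ∈ capBalancedSet L ∧ ‖linkEmbed L p.2‖ ≤ R ∧ ‖linkEmbed L q.2‖ ≤ R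
        then ∫ h, transferKernel su2Rep β (orthoTube L p.1 p.2) (gaugeTransform (basedExt L h) (orthoTube L q.1 q.2)) ∂basedMeasure L
        else transferKernel su2Rep ((L : ℝ) ^ 3 * β) p.1 q.1 / transferKernel su2Rep ((L : ℝ) ^ 3 * β) (1 : GaugeConfig 3 1 SU2) 1 * cM L β p.2 q.2)| ≤
      Real.exp (β * (2 * (Fintype.card (Edge 3 L) : ℝ))) := by
  split_ifs with hc
  · exact abs_basedKernel_le hβ _ _
  · have hρ0 : 0 ≤ transferKernel su2Rep ((L : ℝ) ^ 3 * β) p.1 q.1 / transferKernel su2Rep ((L : ℝ) ^ 3 * β) (1 : GaugeConfig 3 1 SU2) 1 :=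
      (div_pos (transferKernel_pos _ _ _ _) (transferKernel_pos _ _ _ _)).le
    have hρ1 : transferKernel su2Rep ((L : ℝ) ^ 3 * β) p.1 q.1 / transferKernel su2Rep ((L : ℝ) ^ 3 * β) (1 : GaugeConfig 3 1 SU2) 1 ≤ 1 :=
      (rho_le_exp_neg (L := L) hβ p.1 q.1 0).trans (Real.exp_le_one_iff.mpr (neg_nonpos.mpr (by positivity)))
    have hM0 : 0 ≤ cM L β p.2 q.2 := basedIntegral_nonneg β _ _
    have hM1 : cM L β p.2 q.2 ≤ Real.exp (β * (2 * (Fintype.card (Edge 3 L) : ℝ))) := basedIntegral_le_expCard hβ _ _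
    rw [abs_of_nonneg (mul_nonneg hρ0 hM0)]
    calc _ ≤ 1 * cM L β p.2 q.2 := mul_le_mul_of_nonneg_right hρ1 hM0
      _ ≤ _ := by rw [one_mul]; exact hM1

/-! ## §2 The test function `V (u,x) = 𝟙[x ∈ Bal_cap]·v(orthoTube u x)` -/

/-- `V` is measurable and bounded like `v`. [folklore] -/
theorem tubeTest_props {v : GaugeConfig 3 L SU2 → ℝ} (hv : Measurable v) {Cv : ℝ} (hCv : ∀ U, |v U| ≤ Cv) :
    Measurable (fun p : GaugeConfig 3 1 SU2 × (Edge 3 L → Fin 3 → ℝ) => (capBalancedSet L).indicator (fun x => v (orthoTube L p.1 x)) p.2) ∧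
      ∀ p : GaugeConfig 3 1 SU2 × (Edge 3 L → Fin 3 → ℝ), |(capBalancedSet L).indicator (fun x => v (orthoTube L p.1 x)) p.2| ≤ Cv := by
  have hCv0 : 0 ≤ Cv := (abs_nonneg _).trans (hCv 1)
  refine ⟨?_, fun p => ?_⟩
  · have h1 : Measurable fun p : GaugeConfig 3 1 SU2 × (Edge 3 L → Fin 3 → ℝ) => v (orthoTube L p.1 p.2) := hv.comp (measurable_orthoTube (L := L))
    have e : (fun p : GaugeConfig 3 1 SU2 × (Edge 3 L → Fin 3 → ℝ) => (capBalancedSet L).indicator (fun x => v (orthoTube L p.1 x)) p.2) =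
        (Prod.snd ⁻¹' capBalancedSet L).indicator (fun p : GaugeConfig 3 1 SU2 × (Edge 3 L → Fin 3 → ℝ) => v (orthoTube L p.1 p.2)) := by
      funext p
      by_cases hp : p.2 ∈ capBalancedSet L
      · rw [Set.indicator_of_mem hp, Set.indicator_of_mem (show p ∈ Prod.snd ⁻¹' capBalancedSet L from hp)]
      · rw [Set.indicator_of_notMem hp, Set.indicator_of_notMem (show p ∉ Prod.snd ⁻¹' capBalancedSet L from hp)]
    rw [e]; exact h1.indicator (measurable_snd (measurableSet_capBalancedSet L))
  · by_cases hp : p.2 ∈ capBalancedSet L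
    · rw [Set.indicator_of_mem hp]; exact hCv _
    · rw [Set.indicator_of_notMem hp, abs_zero]; exact hCv0

/-- **Support of `V` in the profile's support**: if `v U ≠ 0 ⇒ ‖relLinkVec U‖ ≤ R` with `R < r_f(β)`, then `V (u,x) ≠ 0 ⇒ x ∈ cS β`. [folklore] -/
theorem tubeTest_support {β R : ℝ} (hR : R < min (1 / 40) (powScale (1 / 2) β * btLog β)) {v : GaugeConfig 3 L SU2 → ℝ}
    (hvR : ∀ U, v U ≠ 0 → ‖relLinkVec L U‖ ≤ R) (u : GaugeConfig 3 1 SU2) (x : Edge 3 L → Fin 3 → ℝ) (hx : x ∉ cS L β) :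
    (capBalancedSet L).indicator (fun x => v (orthoTube L u x)) x = 0 := by
  by_cases hcap : x ∈ capBalancedSet L
  · rw [Set.indicator_of_mem hcap]
    by_contra hne
    apply hx
    show cΘ L β x ≠ 0
    have hn : ‖linkEmbed L x‖ ≤ R := by rw [← relLinkVec_orthoTube L u hcap]; exact hvR _ hne
    unfold cΘ cΩ
    have hmem : linkEmbed L x ∈ {y : LinkSpace L | linkCurry y ∈ capBalancedSet L} := by
      show linkCurry (linkEmbed L x) ∈ capBalancedSet L
      have e : linkCurry (linkEmbed L x) = x := by funext e a; rfl
      rw [e]; exact hcap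
    rw [Set.indicator_of_mem hmem, one_mul]
    exact frozenProfile_ne_zero_of_norm_lt _ _ β (lt_of_le_of_lt hn hR)
  · exact Set.indicator_of_notMem hcap _


/-! ## §3 ★★★ The transfer form of the based average is the windowed pair form -/

open Classical in
/-- ★★★ **`⟨P₀v, K_β P₀v⟩ = ∫_p∫_q V p·G_β p q·V q`** for `v` carried by the windows (`v U ≠ 0 ⇒ U ∈ orthoTubeSet`, slow mean in the `δ`-window, `‖relLinkVec U‖ ≤ R`).
[cite: SeilerLNP1982, §3] -/
theorem qform_basedAvg_eq_pairForm (β δ R : ℝ) {v : GaugeConfig 3 L SU2 → ℝ} (hv : Measurable v) {Cv : ℝ} (hCv : ∀ U, |v U| ≤ Cv)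
    (h0 : ∀ U, v U ≠ 0 → U ∈ orthoTubeSet L) (hvwin : ∀ U, v U ≠ 0 → ∀ k : Fin 3, ‖su2Quat (slowMean L U (0, k)) - 1‖ ≤ δ)
    (hvR : ∀ U, v U ≠ 0 → ‖relLinkVec L U‖ ≤ R) :
    qform su2Rep β (fun U => ∫ h, v (gaugeTransform (basedExt L h) U) ∂basedMeasure L) (fun U => ∫ h, v (gaugeTransform (basedExt L h) U) ∂basedMeasure L) =
      ∫ p, ∫ q, (capBalancedSet L).indicator (fun x => v (orthoTube L p.1 x)) p.2 *
          (if (∀ k : Fin 3, ‖su2Quat (p.1 (0, k)) - 1‖ ≤ δ) ∧ (∀ k : Fin 3, ‖su2Quat (q.1 (0, k)) - 1‖ ≤ δ) ∧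
                p.2 ∈ capBalancedSet L ∧ q.2 ∈ capBalancedSet L ∧ ‖linkEmbed L p.2‖ ≤ R ∧ ‖linkEmbed L q.2‖ ≤ R
              then ∫ h, transferKernel su2Rep β (orthoTube L p.1 p.2) (gaugeTransform (basedExt L h) (orthoTube L q.1 q.2)) ∂basedMeasure L
              else transferKernel su2Rep ((L : ℝ) ^ 3 * β) p.1 q.1 / transferKernel su2Rep ((L : ℝ) ^ 3 * β) (1 : GaugeConfig 3 1 SU2) 1 * cM L β p.2 q.2) *
          (capBalancedSet L).indicator (fun x => v (orthoTube L q.1 x)) q.2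
        ∂(configMeasure SU2 1).prod (orthoTransverse L) ∂(configMeasure SU2 1).prod (orthoTransverse L) := by
  haveI := isFiniteMeasure_orthoTransverse L
  obtain ⟨M, hM⟩ := basedKernel_bounds (L := L) β
  have hFb : ∀ U V : GaugeConfig 3 L SU2, |∫ h, transferKernel su2Rep β U (gaugeTransform (basedExt L h) V) ∂basedMeasure L| ≤ M := fun U V => by
    rw [abs_of_nonneg (hM U V).1]; exact (hM U V).2
  rw [qform_basedAvg_eq_basedKernel_form β hv hCv,
    kernelForm_eq_tube_integral hv hCv (fun U hU => by by_contra hne; exact hU (h0 U hne)) (F := fun U V => ∫ h, transferKernel su2Rep β U (gaugeTransform (basedExt L h) V) ∂basedMeasure L)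
      (measurable_basedKernel_uncurry (L := L) β) hFb]
  -- a.e. the fibre point lies in the cap
  have hnull : ((configMeasure SU2 1).prod (orthoTransverse L)) (Prod.snd ⁻¹' (capBalancedSet L)ᶜ) = 0 := by
    have e : (Prod.snd ⁻¹' (capBalancedSet L)ᶜ : Set (GaugeConfig 3 1 SU2 × (Edge 3 L → Fin 3 → ℝ))) = Set.univ ×ˢ (capBalancedSet L)ᶜ := by
      ext p; simp
    rw [e, Measure.prod_prod, orthoTransverse_compl_capBalancedSet, mul_zero]
  have hae : ∀ᵐ p ∂(configMeasure SU2 1).prod (orthoTransverse L), p.2 ∈ capBalancedSet L := by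
    rw [ae_iff]; exact measure_mono_null (fun p hp => hp) hnull
  refine integral_congr_ae (hae.mono fun p hp => ?_)
  refine integral_congr_ae (hae.mono fun q hq => ?_)
  simp only [Set.indicator_of_mem hp, Set.indicator_of_mem hq]
  by_cases hvp : v (orthoTube L p.1 p.2) = 0
  · rw [hvp, zero_mul, zero_mul, zero_mul, zero_mul]
  by_cases hvq : v (orthoTube L q.1 q.2) = 0
  · rw [hvq, mul_zero, mul_zero]
  have hwp : ∀ k : Fin 3, ‖su2Quat (p.1 (0, k)) - 1‖ ≤ δ := by
    have h := hvwin _ hvp; rwa [slowMean_orthoTube L p.1 hp] at h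
  have hwq : ∀ k : Fin 3, ‖su2Quat (q.1 (0, k)) - 1‖ ≤ δ := by
    have h := hvwin _ hvq; rwa [slowMean_orthoTube L q.1 hq] at h
  have hRp : ‖linkEmbed L p.2‖ ≤ R := by rw [← relLinkVec_orthoTube L p.1 hp]; exact hvR _ hvp
  have hRq : ‖linkEmbed L q.2‖ ≤ R := by rw [← relLinkVec_orthoTube L q.1 hq]; exact hvR _ hvq
  rw [if_pos ⟨hwp, hwq, hp, hq, hRp, hRq⟩]

/-! ## §4 ★★★ The core pair form bound -/

open Classical in
/-- ★★★ **THE CORE PIECE THROUGH THE SLOW ⊗ FIBRE ASSEMBLY, β-pointwise**: for `v` carried by the windows and by `U × S`, with the literal `hnear` (for `G_β`, `k = K₁/K₁(1,1)`,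
`M = cM β`), `hfib` (for `cM β`, a weight `w`, a profile `Θ` on `S`) and `hkop` (for `k`), the transfer form of the based average of `v` obeys the conclusion of
✓`form_le_of_product_near` with `V (u,x) = 𝟙[x ∈ Bal_cap]·v(orthoTube u x)`. [cite: Luscher1983, §3] [cite: SeilerLNP1982, §3] -/
theorem core_pairForm_le {β δ R : ℝ} (hβ : 0 ≤ β) {v : GaugeConfig 3 L SU2 → ℝ} (hv : Measurable v) {Cv : ℝ} (hCv : ∀ U, |v U| ≤ Cv)
    (h0 : ∀ U, v U ≠ 0 → U ∈ orthoTubeSet L) (hvwin : ∀ U, v U ≠ 0 → ∀ k : Fin 3, ‖su2Quat (slowMean L U (0, k)) - 1‖ ≤ δ)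
    (hvR : ∀ U, v U ≠ 0 → ‖relLinkVec L U‖ ≤ R) {S : Set (Edge 3 L → Fin 3 → ℝ)}
    (hVS : ∀ (u : GaugeConfig 3 1 SU2) (x : Edge 3 L → Fin 3 → ℝ), x ∉ S → (capBalancedSet L).indicator (fun x => v (orthoTube L u x)) x = 0)
    {w Θ : (Edge 3 L → Fin 3 → ℝ) → ℝ} {Cw CΘ : ℝ} (hw : Measurable w) (hwb : ∀ x, |w x| ≤ Cw) (hw0 : ∀ x, 0 ≤ w x) (hΘ : Measurable Θ) (hΘb : ∀ x, |Θ x| ≤ CΘ)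
    (hZ : 0 < ∫ x, Θ x ^ 2 * w x ∂orthoTransverse L) {Λ θ₁ A₁ A₂ ηt τ κ₀ : ℝ} (hΛ : 0 ≤ Λ) (hθ : 0 ≤ 1 - θ₁) (hA₁ : 0 ≤ A₁) (hA₂ : 0 ≤ A₂) (hηt : 0 ≤ ηt)
    (hnear : ∀ p q : GaugeConfig 3 1 SU2 × (Edge 3 L → Fin 3 → ℝ),
      |(if (∀ k : Fin 3, ‖su2Quat (p.1 (0, k)) - 1‖ ≤ δ) ∧ (∀ k : Fin 3, ‖su2Quat (q.1 (0, k)) - 1‖ ≤ δ) ∧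
            p.2 ∈ capBalancedSet L ∧ q.2 ∈ capBalancedSet L ∧ ‖linkEmbed L p.2‖ ≤ R ∧ ‖linkEmbed L q.2‖ ≤ R
          then ∫ h, transferKernel su2Rep β (orthoTube L p.1 p.2) (gaugeTransform (basedExt L h) (orthoTube L q.1 q.2)) ∂basedMeasure L
          else transferKernel su2Rep ((L : ℝ) ^ 3 * β) p.1 q.1 / transferKernel su2Rep ((L : ℝ) ^ 3 * β) (1 : GaugeConfig 3 1 SU2) 1 * cM L β p.2 q.2) -
          transferKernel su2Rep ((L : ℝ) ^ 3 * β) p.1 q.1 / transferKernel su2Rep ((L : ℝ) ^ 3 * β) (1 : GaugeConfig 3 1 SU2) 1 * cM L β p.2 q.2| ≤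
        ηt * (transferKernel su2Rep ((L : ℝ) ^ 3 * β) p.1 q.1 / transferKernel su2Rep ((L : ℝ) ^ 3 * β) (1 : GaugeConfig 3 1 SU2) 1 * cM L β p.2 q.2) + τ)
    (hfib : ∀ f f' : (Edge 3 L → Fin 3 → ℝ) → ℝ, Measurable f → (∃ C : ℝ, ∀ x, |f x| ≤ C) → (∀ x, x ∉ S → f x = 0) → Measurable f' → (∃ C : ℝ, ∀ x, |f' x| ≤ C) →
      (∀ x, x ∉ S → f' x = 0) →
      ∫ x, ∫ y, f x * cM L β x y * f' y ∂orthoTransverse L ∂orthoTransverse L ≤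
        Λ * ((1 - θ₁) * (Real.sqrt (∫ x, f x ^ 2 * w x ∂orthoTransverse L) * Real.sqrt (∫ x, f' x ^ 2 * w x ∂orthoTransverse L)) +
          A₁ * (|∫ x, f x * Θ x * w x ∂orthoTransverse L| / Real.sqrt (∫ x, Θ x ^ 2 * w x ∂orthoTransverse L) *
            (|∫ x, f' x * Θ x * w x ∂orthoTransverse L| / Real.sqrt (∫ x, Θ x ^ 2 * w x ∂orthoTransverse L))) +
          A₂ * (|∫ x, f x * Θ x * w x ∂orthoTransverse L| / Real.sqrt (∫ x, Θ x ^ 2 * w x ∂orthoTransverse L) * Real.sqrt (∫ x, f' x ^ 2 * w x ∂orthoTransverse L) +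
            |∫ x, f' x * Θ x * w x ∂orthoTransverse L| / Real.sqrt (∫ x, Θ x ^ 2 * w x ∂orthoTransverse L) * Real.sqrt (∫ x, f x ^ 2 * w x ∂orthoTransverse L))))
    (hkop : ∀ a b : GaugeConfig 3 1 SU2 → ℝ, Measurable a → Measurable b → (∃ C : ℝ, ∀ u, |a u| ≤ C) → (∃ C : ℝ, ∀ u, |b u| ≤ C) → (∀ u, 0 ≤ a u) → (∀ u, 0 ≤ b u) →
      ∫ u, ∫ u', a u * (transferKernel su2Rep ((L : ℝ) ^ 3 * β) u u' / transferKernel su2Rep ((L : ℝ) ^ 3 * β) (1 : GaugeConfig 3 1 SU2) 1) * b u'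
          ∂configMeasure SU2 1 ∂configMeasure SU2 1 ≤
        κ₀ * (Real.sqrt (∫ u, a u ^ 2 ∂configMeasure SU2 1) * Real.sqrt (∫ u, b u ^ 2 ∂configMeasure SU2 1))) :
    qform su2Rep β (fun U => ∫ h, v (gaugeTransform (basedExt L h) U) ∂basedMeasure L) (fun U => ∫ h, v (gaugeTransform (basedExt L h) U) ∂basedMeasure L) ≤
      κ₀ * Λ * ((1 - θ₁) * (∫ u, ∫ x, (capBalancedSet L).indicator (fun x => v (orthoTube L u x)) x ^ 2 * w x ∂orthoTransverse L ∂configMeasure SU2 1) +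
          A₁ * (∫ u, (∫ x, (capBalancedSet L).indicator (fun x => v (orthoTube L u x)) x * Θ x * w x ∂orthoTransverse L) ^ 2 /
            (∫ x, Θ x ^ 2 * w x ∂orthoTransverse L) ∂configMeasure SU2 1) +
          2 * A₂ * (Real.sqrt (∫ u, ∫ x, (capBalancedSet L).indicator (fun x => v (orthoTube L u x)) x ^ 2 * w x ∂orthoTransverse L ∂configMeasure SU2 1) *
            Real.sqrt (∫ u, (∫ x, (capBalancedSet L).indicator (fun x => v (orthoTube L u x)) x * Θ x * w x ∂orthoTransverse L) ^ 2 /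
              (∫ x, Θ x ^ 2 * w x ∂orthoTransverse L) ∂configMeasure SU2 1)) +
          ηt * ((1 - θ₁) + A₁ + 2 * A₂) * (∫ u, ∫ x, (capBalancedSet L).indicator (fun x => v (orthoTube L u x)) x ^ 2 * w x ∂orthoTransverse L ∂configMeasure SU2 1)) +
        τ * (∫ p, |(capBalancedSet L).indicator (fun x => v (orthoTube L p.1 x)) p.2| ∂(configMeasure SU2 1).prod (orthoTransverse L)) ^ 2 := by
  haveI := isFiniteMeasure_orthoTransverse L
  rw [qform_basedAvg_eq_pairForm β δ R hv hCv h0 hvwin hvR]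
  obtain ⟨hVm, hVb⟩ := tubeTest_props (L := L) hv hCv
  obtain ⟨hMm, ⟨CM, hMb⟩, -, -, -⟩ := central_kform_data (L := L) hβ
  have hk : Measurable (Function.uncurry fun u u' : GaugeConfig 3 1 SU2 =>
      transferKernel su2Rep ((L : ℝ) ^ 3 * β) u u' / transferKernel su2Rep ((L : ℝ) ^ 3 * β) (1 : GaugeConfig 3 1 SU2) 1) :=
    ((continuous_transferKernel su2Rep continuous_su2Rep _).measurable).div_const _
  have hkb : ∀ u u' : GaugeConfig 3 1 SU2, |transferKernel su2Rep ((L : ℝ) ^ 3 * β) u u' / transferKernel su2Rep ((L : ℝ) ^ 3 * β) (1 : GaugeConfig 3 1 SU2) 1| ≤ 1 :=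
    fun u u' => by
      rw [abs_of_nonneg (div_pos (transferKernel_pos _ _ _ _) (transferKernel_pos _ _ _ _)).le]
      exact (rho_le_exp_neg (L := L) hβ u u' 0).trans (Real.exp_le_one_iff.mpr (neg_nonpos.mpr (by positivity)))
  have hk0 : ∀ u u' : GaugeConfig 3 1 SU2, 0 ≤ transferKernel su2Rep ((L : ℝ) ^ 3 * β) u u' / transferKernel su2Rep ((L : ℝ) ^ 3 * β) (1 : GaugeConfig 3 1 SU2) 1 :=
    fun u u' => (div_pos (transferKernel_pos _ _ _ _) (transferKernel_pos _ _ _ _)).le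
  exact StiffDoor.form_le_of_product_near (ν := configMeasure SU2 1) (μ := orthoTransverse L) hVm hVb (fun u x hx => hVS u x hx)
    (measurable_windowedKernel (L := L) β δ R) (fun p q => abs_windowedKernel_le hβ δ R p q) hk hkb hk0 hMm hMb hw hwb hw0 hΘ hΘb hZ hΛ hθ hA₁ hA₂ hηt
    hnear hfib hkop

end Summit.QuantumFields.YangMills.Theorems.FemtoTransferGap.TwoLattice.ConstTube

end
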